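import Mathlib
import HarnessLib
import Summits.Langlands.Langlands.Theses.HolomorphicShadow

/-!
# Birth skeleton (BC3) for crux stmt-Langlands-13894
`Summit.Langlands.Langlands.Theses.HolomorphicShadow.ShadowModularity` — line `birth`

Route `route-Langlands-HolomorphicShadow` (`closes : ShadowModularity → ShadowConverse → SectorComplement →
Langlands`).  The crux (rank 2, the route's bet): for every irreducible `σ : Γ_ℚ → GL₂(ℂ)` and every admissible
Artin datum `(N, χ, ε, a)` (parity pin `σ(c) = ε·1`, Euler pin of `a` to `σ` away from `N`) there is a level
`L₀ > 0`, `N ∣ L₀`, such that for every weight `k ≥ 4`, every level `L` with `L₀ ∣ L`, every `ψ mod L` and every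
`g ∈ S_k(Γ₀(L), ψ)` the holomorphic shadow `H_(a,ε,g)` converges and lies in `S_k(Γ₀(L), χψ)`.

This file is the skeleton that concludes the crux BY NAME from three named stubs, in the one proof shape the
route header itself records for it ("TRUE if σ is automorphic: φ_a is the Maass newform of σ with its Euler
factors at p ∣ N stripped, automorphic of level dividing L₀; then Sturm forward"):

* `stub_maassAutomorphy` (ARITHMETIC INPUT — the load-bearing, conjecture-grade stub): for irreducible `σ` and an
  admissible datum there is a level `L₀ > 0`, `N ∣ L₀`, at which the Maass lift `φ_(a,ε)` is `Γ₀(L₀)`-automorphic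
  with character `d ↦ χ(d mod N)` AND bounded on `ℍ`.  True if `σ` is automorphic (even strong Artin in
  Maass-form form: the `λ = 1/4` newform of `σ`, oldform-raised by `f ↦ f − λ_p f(p·) + χ(p) f(p²·)` at the good
  `p ∣ N` and `f ↦ f − λ_p f(p·)` at the bad ones, is cuspidal because `σ` is irreducible, hence bounded);
  vacuous for odd `σ`.  Its automorphy clause is, up to the boundedness conjunct, the antecedent of the junction
  crux `SectorComplement` and the hypothesis of the support `MaassEigenformStrongArtin` — so closing this stub
  feeds `closes` directly.  [cite: Gelbart1975, §3] [cite: DoudMoore2006, §4]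
* `stub_sturmProjection` (ANALYTIC — Sturm's holomorphic projection computed for THIS kernel, threshold
  sharpened to `k ≥ 4`): if `φ_(a,ε)` is `Γ₀(L₀)`-automorphic with character `χ(· mod N)` (`N ∣ L₀`), bounded, and
  `a` has sub-polynomial growth `‖a_n‖ ≤ C_δ (n+1)^δ` for every `δ > 0`, then for every `k ≥ 4`, `L₀ ∣ L`,
  `ψ mod L`, `g ∈ S_k(Γ₀(L), ψ)`: `ShadowInS a ε k b L (χψ)`.  `F = φ·g` is smooth of weight `k`, character `χψ`,
  with `|F|_k α| ≪ y^{-k/2}` at every cusp, so for `k > 2` Sturm's Theorem 1 gives `h = Σ c(m) e(mz) ∈ S_k(Γ₀(L), χψ)`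
  with `c(m) = (4πm)^{k-1}/Γ(k-1) ∫_0^∞ F_m(y) e^{-2πmy} y^{k-2} dy`; the Cauchy product of the two Fourier series and
  the `m'`-sum/`y`-integral interchange (absolutely convergent iff `k > 3 + 2δ`: `|b_{m'}| ≪ m'^{k/2}`,
  `I_k(m,m') ≪ m'^{-(k-1/2)} log m'`) identify `c(m)` with the typed `coeff`.  It is the support item
  `ShadowNecessity` (stmt-Langlands-11634) with the level of automorphy decoupled from the modulus of `χ` and the
  threshold `2A + 4 < k` replaced by (`δ` arbitrary, `k ≥ 4`) — the form the crux needs at `k = 4`.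
  [cite: Sturm1980, Thm 1] [cite: GrossZagier1986, §IV.5]
* `stub_eulerPinGrowth` (ELEMENTARY ARITHMETIC — Ramanujan for Artin data): the Euler pin forces
  `‖a_n‖ ≤ C_δ (n+1)^δ` for every `δ > 0`: `σ` has finite image, so `a_p = tr σ(Frob_p)` is a sum of two roots of
  unity with product `χ(p)`, the recursion gives `a(p^j) = Σ_{i ≤ j} α^i β^{j-i}`, `|a(p^j)| ≤ j + 1`, hence
  `|a_n| ≤ d(n)` for `(n, N) = 1`, `a_n = 0` otherwise (`n ≥ 1`), and `d(n) ≪_δ n^δ`.  Load-bearing at `k = 4`: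
  boundedness of `φ` alone only gives `|a_n| ≪ n^{1/2}`, i.e. `k ≥ 5`.  [cite: SerreAbelianLadic1968, Ch. I §2]

Shape (for `ledger skeleton check` / `#h21_check_skeleton`): §0 are VERBATIM named copies of the crux's `let`
gadgets (and of the `let maass` of its sibling items), so that `shadowModularity_iff` is `Iff.rfl`; each stub is a
closed statement `theorem stub_<name> : <Prop> := by sorry` over them; `_Goal.stub_<name> : Prop := type_of% @stub_<name>`
names that statement; `ShadowModularity_of (hA : _Goal.stub_maassAutomorphy) (hB : _Goal.stub_sturmProjection)
(hC : _Goal.stub_eulerPinGrowth) : ShadowModularity` is proved WITHOUT `sorry` and concludes the route decl BY NAME;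
the last `example` feeds the three stubs to it.  Sorries: exactly three, one per stub, none elsewhere.

Disproof used: none on file (`ledger crux ls stmt-Langlands-13894`: no Disproof.lean, no Negative lemma, no dead
line at registration time, 2026-08-17).
-/

set_option linter.dupNamespace false
set_option linter.unusedVariables false

noncomputable section

namespace Summit.Langlands.Langlands.Cruxes.ShadowModularity.Birth

open scoped BigOperators Topology Manifold Classical MeasureTheory ProbabilityTheory Matrix InnerProductSpace ComplexConjugate ContinuousMap
open Filter Set Function TopologicalSpace MeasureTheory
open Summit.Langlands.Langlands.Theses.HolomorphicShadow

/-! ## 0. Named copies of the crux's `let` gadgets (verbatim; `shadowModularity_iff` is `Iff.rfl`) -/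

/-- The Bessel kernel `K₀(x) = ∫_0^∞ e^{-x cosh t} dt` (verbatim copy of the crux's `let K0`). [folklore] -/
def K0 : ℝ → ℝ := fun x => ∫ t in Set.Ioi (0 : ℝ), Real.exp (-(x * Real.cosh t))

/-- The parity-`ε` Maass lift `φ_(a,ε)(z) = Σ_{n≥1} a_n √y K₀(2πny)(e(nx) + ε e(-nx))` (verbatim copy of the `let maass` of ShadowConverse / SectorComplement / MaassEigenformStrongArtin). [folklore] -/
def maass : (ℕ → ℂ) → ℂ → UpperHalfPlane → ℂ := fun a ε z => ∑' n : ℕ, a (n + 1) * ((Real.sqrt z.im * K0 (2 * Real.pi * ((n : ℝ) + 1) * z.im) : ℝ) : ℂ) * (Complex.exp (2 * Real.pi * Complex.I * ((n : ℂ) + 1) * (z.re : ℂ)) + ε * Complex.exp (-(2 * Real.pi * Complex.I * ((n : ℂ) + 1) * (z.re : ℂ))))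

/-- The four-clause cusp-form predicate `g ∈ S_k(Γ₀(L), ω)`: q-series with coefficients `b`, holomorphic, `g(γz) = ω(d)(cz+d)^k g(z)` on `Γ₀(L)`, `y^{k/2}|g|` bounded (verbatim copy of the crux's `let IsCusp`). [folklore] -/
def IsCusp : ℕ → ℕ → (ℤ → ℂ) → (UpperHalfPlane → ℂ) → (ℕ → ℂ) → Prop := fun k L ω g b => (∀ z : UpperHalfPlane, HasSum (fun m : ℕ => b (m + 1) * Complex.exp (2 * Real.pi * Complex.I * ((m : ℂ) + 1) * (z : ℂ))) (g z)) ∧ MDifferentiable (modelWithCornersSelf ℂ ℂ) (modelWithCornersSelf ℂ ℂ) g ∧ (∀ γ ∈ CongruenceSubgroup.Gamma0 L, ∀ z : UpperHalfPlane, g (γ • z) = ω ((γ : Matrix (Fin 2) (Fin 2) ℤ) 1 1) * ((((γ : Matrix (Fin 2) (Fin 2) ℤ) 1 0 : ℤ) : ℂ) * (z : ℂ) + (((γ : Matrix (Fin 2) (Fin 2) ℤ) 1 1 : ℤ) : ℂ)) ^ k * g z) ∧ ∃ C : ℝ, ∀ z : UpperHalfPlane, z.im ^ ((k : ℝ) /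 2) * ‖g z‖ ≤ C

/-- The `y`-integral `I_k(m,m') = ∫_0^∞ y^{k-3/2} K₀(2π|m-m'|y) e^{-2π(m+m')y} dy` of Sturm's coefficient formula (verbatim copy of the crux's `let Ik`). [cite: Sturm1980, Thm 1] -/
def Ik : ℕ → ℕ → ℕ → ℝ := fun k m m' => ∫ y in Set.Ioi (0 : ℝ), y ^ ((k : ℝ) - 3 / 2) * K0 (2 * Real.pi * |(m : ℝ) - (m' : ℝ)| * y) * Real.exp (-(2 * Real.pi * ((m : ℝ) + (m' : ℝ)) * y))

/-- The `m'`-th term of the shifted convolution defining the `m`-th shadow coefficient (verbatim copy of the crux's `let term`). [cite: Sturm1980, Thm 1] -/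
def term : (ℕ → ℂ) → ℂ → ℕ → (ℕ → ℂ) → ℕ → ℕ → ℂ := fun a ε k b m m' => if m' = 0 ∨ m' = m then 0 else (if m' < m then a (m - m') else ε * a (m' - m)) * b m' * ((Ik k m m' : ℝ) : ℂ)

/-- The `m`-th shadow coefficient `c_m = (4πm)^{k-1}/Γ(k-1) · Σ_{m'} term` (verbatim copy of the crux's `let coeff`). [cite: Sturm1980, Thm 1] -/
def coeff : (ℕ → ℂ) → ℂ → ℕ → (ℕ → ℂ) → ℕ → ℂ := fun a ε k b m => (((4 * Real.pi * (m : ℝ)) ^ (k - 1) / Real.Gamma ((k : ℝ) - 1) : ℝ) : ℂ) * ∑' m' : ℕ, term a ε k b m m'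

/-- The holomorphic shadow `H_(a,ε,g)(z) = Σ_{m≥1} c_m e(mz)` as a function on `ℍ` (verbatim copy of the crux's `let shadow`). [cite: Sturm1980, Thm 1] -/
def shadow : (ℕ → ℂ) → ℂ → ℕ → (ℕ → ℂ) → UpperHalfPlane → ℂ := fun a ε k b z => ∑' m : ℕ, coeff a ε k b (m + 1) * Complex.exp (2 * Real.pi * Complex.I * ((m : ℂ) + 1) * (z : ℂ))

/-- `ShadowInS a ε k b L ω`: every shadow coefficient series converges absolutely and the shadow is a cusp form in `S_k(Γ₀(L), ω)` in the four-clause sense (verbatim copy of the crux's `let ShadowInS`). [folklore] -/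
def ShadowInS : (ℕ → ℂ) → ℂ → ℕ → (ℕ → ℂ) → ℕ → (ℤ → ℂ) → Prop := fun a ε k b L ω => (∀ m : ℕ, Summable (term a ε k b m)) ∧ IsCusp k L ω (shadow a ε k b) (coeff a ε k b)

/-- The Euler pin of `a` to `σ` away from `N`: `a₁ = 1`, multiplicative, `a(p^{j+1}) = 0` for `p ∣ N`, and for `p ∤ N` the Frobenius recursion with `charpoly σ(Frob_p) = X² - a_p X + χ(p)`, `σ` unramified at `p` (verbatim copy of the crux's `let EulerPin`). [folklore] -/
def EulerPin : Literature.NumberTheory.GaloisRepresentations.FramedGaloisRep ℚ ℂ 2 → (N : ℕ) → DirichletCharacter ℂ N → (ℕ → ℂ) → Prop := fun σ N χ a => a 1 = 1 ∧ (∀ m n : ℕ, Nat.Coprime m n → a (m * n) = a m * a n) ∧ (∀ p : ℕ, p.Prime → p ∣ N → ∀ j : ℕ, a (p ^ (j + 1)) = 0) ∧ (∀ p : ℕ, p.Prime → ¬ p ∣ N → (∀ j : ℕ, a (p ^ (j + 2)) = a p * a (p ^ (j + 1)) - χ (p : ZMod N) * a (p ^ j)) ∧ ∀ v : IsDedekindDomain.HeightOneSpectrum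 (NumberField.RingOfIntegers ℚ), (p : NumberField.RingOfIntegers ℚ) ∈ v.asIdeal → Literature.NumberTheory.GaloisRepresentations.FramedGaloisRep.IsUnramifiedAt v σ ∧ Literature.NumberTheory.GaloisRepresentations.FramedGaloisRep.HasFrobCharpolyAt v (Polynomial.X ^ 2 - Polynomial.C (a p) * Polynomial.X + Polynomial.C (χ (p : ZMod N))) σ)

/-- The parity pin `σ(c) = ε • 1` at every complex conjugation (verbatim copy of the crux's `let ParityPin`). [folklore] -/
def ParityPin : Literature.NumberTheory.GaloisRepresentations.FramedGaloisRep ℚ ℂ 2 → ℂ → Prop := fun σ ε => ∀ (φ : ℚ →+* ℝ) (c : Field.absoluteGaloisGroup ℚ), Literature.NumberTheory.GaloisRepresentations.IsComplexConjugation φ c → ((σ c : GL (Fin 2) ℂ) : Matrix (Fin 2) (Fin 2) ℂ) = ε • (1 : Matrix (Fin 2) (Fin 2) ℂ)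

/-- The crux unfolded over the named gadgets of §0 (definitional: the `let`s ζ-reduce to these `def`s). [folklore] -/
theorem shadowModularity_iff : ShadowModularity ↔
    (∀ σ : Literature.NumberTheory.GaloisRepresentations.FramedGaloisRep ℚ ℂ 2, σ.toGaloisRep.IsIrreducible → ∀ (N : ℕ) (χ : DirichletCharacter ℂ N) (ε : ℂ) (a : ℕ → ℂ), 0 < N → (ε = 1 ∨ ε = -1) → ParityPin σ ε → EulerPin σ N χ a → ∃ L₀ : ℕ, 0 < L₀ ∧ N ∣ L₀ ∧ ∀ k : ℕ, 4 ≤ k → ∀ L : ℕ, L₀ ∣ L → 0 < L → ∀ (ψ : DirichletCharacter ℂ L) (b : ℕ → ℂ) (g : UpperHalfPlane → ℂ), IsCusp k L (fun d : ℤ => ψ (d : ZMod L)) g b → ShadowInS a ε k b L (fun d : ℤ => χ (d : ZMod N) * ψ (d : ZMod L))) :=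
  Iff.rfl

/-! ## 1. The three stubs (closed statements over the gadgets of §0; `sorry` lives here and only here) -/

/-- **STUB A — Maass automorphy of admissible Artin data at a good level (the arithmetic input; conjecture-grade).**
For irreducible `σ : Γ_ℚ → GL₂(ℂ)` and every admissible Artin datum `(N > 0, χ mod N, ε = ±1 with σ(c) = ε·1,
a` Euler-pinned to `σ` away from `N)` there is a level `L₀ > 0` with `N ∣ L₀` such that the Maass lift
`φ_(a,ε)` satisfies `φ(γz) = χ(d_γ mod N) φ(z)` for all `γ ∈ Γ₀(L₀)` and is bounded on `ℍ`.  Vacuous for odd `σ`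
(`σ(c)` is never scalar); for even `σ` it is even strong Artin over `ℚ` in Maass-form form plus oldform theory:
the `λ = 1/4` newform `f` of `σ` (level `N₀`, nebentypus `det σ`) stripped of its Euler factors at `p ∣ N`
(`f − λ_p f(p·) + χ(p) f(p²·)` for good `p ∣ N`, `f − λ_p f(p·)` for bad ones) has q-coefficients exactly the
Euler-pinned `a`, lives on `Γ₀(lcm(N N₀, N₀ ∏_{p∣N} p²))` with character `χ(· mod N)` (`χ` and `det σ` agree on
`d` prime to `N N₀`), and is cuspidal because `σ` is irreducible, hence bounded.  Why it might fail: it is the even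
slice of (B) for `n = 2` over `ℚ` — false iff some even icosahedral `σ` (minimal prime conductor 1951) is not
automorphic.  Its automorphy clause is the antecedent of `SectorComplement` / the hypothesis of
`MaassEigenformStrongArtin` (same `maass`, `EulerPin`, `ParityPin` gadgets).  Size: open problem.
[cite: Gelbart1975, §3] [cite: DoudMoore2006, §4] [cite: Booker2003, Thm 1] -/
theorem stub_maassAutomorphy :
    ∀ σ : Literature.NumberTheory.GaloisRepresentations.FramedGaloisRep ℚ ℂ 2, σ.toGaloisRep.IsIrreducible → ∀ (N : ℕ) (χ : DirichletCharacter ℂ N) (ε : ℂ) (a : ℕ → ℂ), 0 < N → (ε = 1 ∨ ε = -1) → ParityPin σ ε → EulerPin σ N χ a → ∃ L₀ : ℕ, 0 < L₀ ∧ N ∣ L₀ ∧ (∀ γ ∈ CongruenceSubgroup.Gamma0 L₀, ∀ z : UpperHalfPlane, maass a ε (γ • z) = χ ((((γ : Matrix (Fin 2) (Fin 2) ℤ) 1 1 : ℤ) : ZMod N)) * maass a ε z) ∧ (∃ B : ℝ, ∀ z : UpperHalfPlane, ‖maass a ε z‖ ≤ B) := by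
  sorry

/-- **STUB B — Sturm's holomorphic projection for this kernel, threshold `k ≥ 4` (analytic; true, XL in Lean).**
`N ∣ L₀`, `χ mod N`, `ε = ±1`, `a` of sub-polynomial growth (`∀ δ > 0, ‖a_n‖ ≤ C_δ (n+1)^δ`), `φ_(a,ε)`
`Γ₀(L₀)`-automorphic with character `χ(· mod N)` and bounded: then for every `k ≥ 4`, every `L` with `L₀ ∣ L`,
every `ψ mod L` and every `g ∈ S_k(Γ₀(L), ψ)` (four-clause `IsCusp`), every shadow coefficient series converges
absolutely and `H_(a,ε,g) ∈ S_k(Γ₀(L), χψ)` (`ShadowInS`).  Proof route: `F = φ g` is `C^∞`, `F|_k γ = χ(d)ψ(d) F`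
on `Γ₀(L)`, `|F|_k α| ≤ B C y^{-k/2}` at every cusp, so Sturm's Theorem 1 (`k > 2`) gives `h = Σ c(m) e(mz) ∈
S_k(Γ₀(L), χψ)` with `c(m) = (4πm)^{k-1}/Γ(k-1) ∫_0^∞ F_m(y) e^{-2πmy} y^{k-2} dy`; the Cauchy product of the two
absolutely convergent Fourier series gives `F_m(y) = Σ_{m'≠m} sgn_ε a_{|m-m'|} b_{m'} √y K₀(2π|m-m'|y) e^{-2πm'y}`,
and the `m'`-sum/`y`-integral interchange is absolutely convergent because `|b_{m'}| ≤ C e^{2π} m'^{k/2}`,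
`I_k(m,m') ≪ m'^{-(k-1/2)}(1 + log m')`, `‖a_{m'-m}‖ ≪ m'^δ`: terms `≪ m'^{δ+(1-k)/2} log m'`, summable for
`k > 3 + 2δ`, i.e. for all `k ≥ 4` with `δ = 1/4`; hence `coeff = c`, `shadow = h`.  It is the support item
`ShadowNecessity` (stmt-Langlands-11634) with the automorphy level decoupled from the modulus of `χ` and the
threshold `2A + 4 < k` sharpened to what the crux needs at `k = 4`.  Why it might fail (as typed): only through a
normalisation slip in the gadgets (`y^{k-3/2}`, `sgn_ε`, the `χ(d)` convention) — calibrated numerically on the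
true dihedral form of level 145 (kit j002740).  Size: XL (Petersson product, Poincaré series and unfolding on
`Γ₀(L)` with character are not in Mathlib).  [cite: Sturm1980, Thm 1] [cite: GrossZagier1986, Prop. IV.5.1] -/
theorem stub_sturmProjection :
    ∀ (N L₀ : ℕ) (χ : DirichletCharacter ℂ N) (ε : ℂ) (a : ℕ → ℂ), 0 < N → N ∣ L₀ → 0 < L₀ → (ε = 1 ∨ ε = -1) → (∀ δ : ℝ, 0 < δ → ∃ C : ℝ, ∀ n : ℕ, ‖a n‖ ≤ C * ((n : ℝ) + 1) ^ δ) → (∀ γ ∈ CongruenceSubgroup.Gamma0 L₀, ∀ z : UpperHalfPlane, maass a ε (γ • z) = χ ((((γ : Matrix (Fin 2) (Fin 2) ℤ) 1 1 : ℤ) : ZMod N)) * maass a ε z) → (∃ B : ℝ, ∀ z : UpperHalfPlane, ‖maass a ε z‖ ≤ B) → ∀ k : ℕ, 4 ≤ k → ∀ L : ℕ, L₀ ∣ L → 0 < L → ∀ (ψ : DirichletCharacter ℂ L) (b : ℕ → ℂ) (g : UpperHalfPlane → ℂ), IsCusp k L (fun d : ℤ => ψ (d : ZMod L)) g b → ShadowInS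 a ε k b L (fun d : ℤ => χ (d : ZMod N) * ψ (d : ZMod L)) := by
  sorry

/-- **STUB C — Ramanujan bound for Euler-pinned Artin data (elementary arithmetic; true, M/L in Lean).**
If `a` is Euler-pinned to `σ : Γ_ℚ → GL₂(ℂ)` away from `N > 0` then `‖a_n‖ ≤ C_δ (n+1)^δ` for every `δ > 0`.
Proof route: `σ` is continuous on the profinite `Γ_ℚ` into `GL₂(ℂ)`, so it has finite image; for `p ∤ N` pick a
prime of `ℚ̄` over `p` and an arithmetic Frobenius `τ` there (it exists), so `charpoly σ(τ) = X² − a_p X + χ(p)`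
makes `a_p = α + β`, `χ(p) = αβ` with `α, β` roots of unity; the recursion (seeded by `a_1 = 1`, `a_p`) gives
`a(p^j) = Σ_{i=0}^{j} α^i β^{j-i}`, so `|a(p^j)| ≤ j + 1`; coprime multiplicativity gives `|a_n| ≤ d(n)` for
`(n, N) = 1` and `a_n = 0` for `n ≥ 1` sharing a prime with `N`; finally `d(n) ≤ C_δ n^δ` (and `C ≥ ‖a_0‖` covers the
junk value `a 0`).  Load-bearing at `k = 4`: boundedness of `φ_(a,ε)` alone yields only `|a_n| ≪ n^{1/2}`.  Why it
might fail: it does not, short of a mis-typed `EulerPin` (e.g. if no Frobenius existed above some `p ∤ N`, `a_p` would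
be unconstrained — it does exist).  [cite: SerreAbelianLadic1968, Ch. I §2.3] [cite: Martinet1977, §1] -/
theorem stub_eulerPinGrowth :
    ∀ (σ : Literature.NumberTheory.GaloisRepresentations.FramedGaloisRep ℚ ℂ 2) (N : ℕ) (χ : DirichletCharacter ℂ N) (a : ℕ → ℂ), 0 < N → EulerPin σ N χ a → ∀ δ : ℝ, 0 < δ → ∃ C : ℝ, ∀ n : ℕ, ‖a n‖ ≤ C * ((n : ℝ) + 1) ^ δ := by
  sorry

/-! ## 2. The stub statements as named propositions (the composition's hypotheses, by name)

`_Goal` is an internal name on purpose: audits listing this file's declarations by short name find the `stub_*`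
THEOREMS, while `#h21_check_skeleton` accepts the hypotheses of `ShadowModularity_of` by the stub names they carry.
Each `_Goal.stub_x` is `type_of% @stub_x` — no text is duplicated and no `sorry` is inherited. -/

namespace _Goal

/-- The statement of `stub_maassAutomorphy`, as a named `Prop` (literally its type). [folklore] -/
def stub_maassAutomorphy : Prop :=
  type_of% @Summit.Langlands.Langlands.Cruxes.ShadowModularity.Birth.stub_maassAutomorphy

/-- The statement of `stub_sturmProjection`, as a named `Prop` (literally its type). [folklore] -/
def stub_sturmProjection : Prop :=
  type_of% @Summit.Langlands.Langlands.Cruxes.ShadowModularity.Birth.stub_sturmProjection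

/-- The statement of `stub_eulerPinGrowth`, as a named `Prop` (literally its type). [folklore] -/
def stub_eulerPinGrowth : Prop :=
  type_of% @Summit.Langlands.Langlands.Cruxes.ShadowModularity.Birth.stub_eulerPinGrowth

end _Goal

/-! ## 3. The composition (kernel-checked, no `sorry`): AUTOMORPHY + GROWTH → STURM → the crux by name -/

/-- **ShadowModularity from the three stubs.** Fix `σ` irreducible and an admissible datum `(N, χ, ε, a)`.  STUB A
gives a level `L₀ > 0`, `N ∣ L₀`, with `φ_(a,ε)` `Γ₀(L₀)`-automorphic of character `χ(· mod N)` and bounded; STUB C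
turns the Euler pin into sub-polynomial growth of `a`; STUB B (Sturm forward at threshold `k ≥ 4`) then puts every
shadow against every `S_k(Γ₀(L), ψ)`, `L₀ ∣ L`, into `S_k(Γ₀(L), χψ)` — which is the crux at the witness `L₀`.  The
hypotheses are, by name, the statements of the three stubs; the conclusion is the route decl. [folklore] -/
theorem ShadowModularity_of (hA : _Goal.stub_maassAutomorphy) (hB : _Goal.stub_sturmProjection)
    (hC : _Goal.stub_eulerPinGrowth) : ShadowModularity := by
  rw [shadowModularity_iff]
  intro σ hirr N χ ε a hN hε hpar hpin
  obtain ⟨L₀, hL₀, hNL₀, haut, hbdd⟩ := hA σ hirr N χ ε a hN hε hpar hpin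
  exact ⟨L₀, hL₀, hNL₀, fun k hk L hL₀L hL ψ b g hg =>
    hB N L₀ χ ε a hN hNL₀ hL₀ hε (hC σ N χ a hN hpin) haut hbdd k hk L hL₀L hL ψ b g hg⟩

/-- By-name sanity check (an `example`, not a declaration of the file): the three stubs feed the composition as
they stand. -/
example : ShadowModularity :=
  ShadowModularity_of stub_maassAutomorphy stub_sturmProjection stub_eulerPinGrowth

end Summit.Langlands.Langlands.Cruxes.ShadowModularity.Birth

end
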